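import Summits.BirchSwinnertonDyer.Rank1Residual.GaloisImage.VisibleWitnessHybridPlaces
import Summits.BirchSwinnertonDyer.Rank1Residual.GaloisImage.LocalThreeTorsionDeciderAtCert
import HarnessLib

/-!
# `ι_v(θ) = 1` at a kind-(ii) place from the CERTIFICATE-FORM `3`-torsion decider
# (team n1011, ROW T-VIS3-TATE two-filer lane, seat p17 GEN 12; the certificate-form twin of FILE D9's
# `DivisionDecider.relIndex_eq_one_of_kindII_checks_of_intModel` over n1011-p04's T-D31891 FILES 1–2)

HONEST FRAMING (cell `b2b-bsdres`, run/shared/lean/b2b/bsd-rank1-residual/, verbatim in every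
file): the goal of the cell is to DELETE the COMBINATION-SHAPED residual classes of the
Birch–Swinnerton-Dyer formula for ALL analytic-rank `≤ 1` elliptic curves over `ℚ` — "full BSD
formula for every rank `≤ 1` curve in class `C`" assembled STRICTLY from published theorems — so
that the rank-`≤ 1` remainder becomes exactly the CONSTRUCTION-SHAPED classes, which are TYPED
(missing-input `Prop`s), NOT attempted. This is not "finishing BSD". Team n1011 (N10/N11): research
route; this file is a TOOL (assembly of tree theorems with kernel numerals); nothing is booked by
it; no mark / label moved; X4 stays CONSTRUCTION-SHAPED. ONE THEOREM; no definition, no named fact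
of ours (Tate's uniformisation `hU` = the registered hypothesis of the tree's
`relIndex_map_selmerLocalKer_eq_one_of_hasSplitMultiplicativeReductionAt` is DISPLAYED, exactly as in
FILE D9), no `sorry`.

## What

FILE D9 (`GaloisImage/VisibleWitnessHybridPlaces.lean`) discharges the comparison
`ι_v(θ) : (𝓢_v E).relIndex (θ_* 𝓢_v E′) = 1` at a place `v` of a prime `q ≠ 3` of r1's kind (ii) —
both `3`-congruent curves SPLIT multiplicative at `v`, `#E(ℚ_v)[3] ≤ 3` — from decidable data on the
global minimal models, the count `#E(ℚ_v)[3] = 1 + 2S ≤ 3` being read off n1011-p17's ENUMERATIVE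
decider `threeTorsionCheckAt q …` (T-LOC3L FILE L5).  That decider's residue search enumerates all
`q` residues and does not elaborate under `decide +kernel` at a five-digit prime (`q = 22963`, the
multiplicative place of the two N11 rows 413334i1, 413334j1 of the T-VIS3-TATE lane: "maximum
recursion depth"; n1011-p04 met the same wall at `q = 31891`, road D44).  n1011-p04's T-D31891 files
replace the residue search by a SPLIT-COVER CERTIFICATE (`threeTorsionCertAt q a₁ … a₆ k cert lin`,
FILE 1 `PadicRootCensusSplitCover`; consumer theorems FILE 2 `LocalThreeTorsionDeciderAtCert`, among
them `natCard_ker_nsmul_three_adicCompletion_eq_of_intModel_of_certAt`, the twin of FILE L5's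
`…_of_checkAt`), whose cost is independent of `q`; at every multiplicative `q ≥ 5` the `3`-division
polynomial splits mod `q` as `3 (X − x_t)(X − x₀)³`, so such a certificate always exists there.

* `relIndex_eq_one_of_kindII_certs_of_intModel` — FILE D9's `relIndex_eq_one_of_kindII_checks_of_intModel`
  with the single hypothesis `threeTorsionCheckAt q a₁ … a₆ k cert = some S` replaced by
  `threeTorsionCertAt q a₁ … a₆ k cert lin = some S`; every other binder, and the conclusion, token for
  token the same; proof = D9's two split-multiplicativity lemmas
  `hasSplitMultiplicativeReductionAt_of_intModel_of_root` + p04's `…_of_certAt` + the tree's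
  `relIndex_map_selmerLocalKer_eq_one_of_hasSplitMultiplicativeReductionAt` BY NAME.

First consumer: the T-VIS3-TATE records of 413334i1 / 413334j1 at `q = 22963`
(`Additive/X4ThreeVisibleTateRowShapesT378.lean`).  NOT claimed: anything at `q = 3`, any congruence,
rank certificate or record.  References: [SilvermanATAEC1994] V.3.1, V.5.3; [SilvermanAEC2009]
VII.5.1 (b), VII.3.1, Ex. 3.7; cells/n1011/ROUTE-1.md §65.1 (design note D-31891).
-/

set_option autoImplicit false

noncomputable section

open scoped Classical

open WeierstrassCurve NumberField IsDedekindDomain Rat.HeightOneSpectrum Field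
  Literature.NumberTheory.EllipticCurves Literature.NumberTheory.GaloisRepresentations
open Summit.BirchSwinnertonDyer.Rank1Residual.GaloisImage.LocalTorsion3At
  (threeTorsionCertAt natCard_ker_nsmul_three_adicCompletion_eq_of_intModel_of_certAt)

namespace Summit.BirchSwinnertonDyer.Rank1Residual.GaloisImage.DivisionDecider

section KindIICert

variable (q : ℕ) [hq : Fact q.Prime]

/-- **Kind (ii) by certificate, `integralModelInt` currency: `ι_v(θ) = 1` at a place `v` of a prime
`q ≠ 3` where both `3`-congruent curves are SPLIT multiplicative (root certificates `t`, `t′` of the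
two node-tangent quadratics) and `#E(ℚ_v)[3] ≤ 3` from the CERTIFICATE-FORM decider
`threeTorsionCertAt q … k cert lin = some S` on `E₀` with `S ≤ 1`** — FILE D9's
`relIndex_eq_one_of_kindII_checks_of_intModel` with n1011-p04's split-cover certificate in place of
the enumerative check; conditional on Tate's uniformisation `hU` (displayed).
[cite: SilvermanATAEC1994, Ch. V Thm. 3.1, Thm. 5.3]
[cite: SilvermanAEC2009, VII.5 Prop. 5.1(b) and VII.1 Prop. 1.3(b)] -/
theorem relIndex_eq_one_of_kindII_certs_of_intModel
    (hU : Silverman1994_thmV53_tateUniformisation.{0})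
    (W W' : WeierstrassCurve ℚ) [W.IsElliptic] [W'.IsElliptic] [W.IsGloballyMinimal]
    [W'.IsGloballyMinimal] {a₁ a₂ a₃ a₄ a₆ : ℤ} {F₀ : WeierstrassCurve ℤ}
    (hI : W.integralModelInt = ⟨a₁, a₂, a₃, a₄, a₆⟩) (hI' : W'.integralModelInt = F₀)
    (θ : geomTorsion W' ((3 : ℕ) : ℤ) ≃+ geomTorsion W ((3 : ℕ) : ℤ))
    (hθ : ∀ (σ : Field.absoluteGaloisGroup ℚ) (P : geomTorsion W' ((3 : ℕ) : ℤ)),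
      θ (σ • P) = σ • θ P)
    (hq3 : q ≠ 3) {v : HeightOneSpectrum (𝓞 ℚ)} (hv : (primesEquiv v : ℕ) = q)
    (hΔ : (q : ℤ) ∣ (⟨a₁, a₂, a₃, a₄, a₆⟩ : WeierstrassCurve ℤ).Δ)
    (hc₄ : ¬ (q : ℤ) ∣ (⟨a₁, a₂, a₃, a₄, a₆⟩ : WeierstrassCurve ℤ).c₄)
    (hΔ' : (q : ℤ) ∣ F₀.Δ) (hc₄' : ¬ (q : ℤ) ∣ F₀.c₄) (t t' : ZMod q)
    (ht : letI E₀ : WeierstrassCurve ℤ := ⟨a₁, a₂, a₃, a₄, a₆⟩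
      (E₀.c₄ : ZMod q) * t ^ 2 + ((E₀.a₁ * E₀.c₄ : ℤ) : ZMod q) * t -
        ((54 * E₀.b₆ - 3 * E₀.b₂ * E₀.b₄ + E₀.a₂ * E₀.c₄ : ℤ) : ZMod q) = 0)
    (ht' : (F₀.c₄ : ZMod q) * t' ^ 2 + ((F₀.a₁ * F₀.c₄ : ℤ) : ZMod q) * t' -
        ((54 * F₀.b₆ - 3 * F₀.b₂ * F₀.b₄ + F₀.a₂ * F₀.c₄ : ℤ) : ZMod q) = 0)
    {k S : ℕ} {cert : List (ℤ × ℕ × ℕ × ℕ)} {lin : List (ℤ × ℕ)} (hS : S ≤ 1)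
    (hcert : threeTorsionCertAt q a₁ a₂ a₃ a₄ a₆ k cert lin = some S) :
    haveI : Fact (Nat.Prime 3) := ⟨Nat.prime_three⟩
    (selmerLocalKer W (v.adicCompletion ℚ) ((3 : ℕ) : ℤ)).relIndex
        ((selmerLocalKer W' (v.adicCompletion ℚ) ((3 : ℕ) : ℤ)).map
          (h1Equiv θ hθ).toAddMonoidHom) = 1 := by
  haveI : Fact (Nat.Prime 3) := ⟨Nat.prime_three⟩
  have hWs := hasSplitMultiplicativeReductionAt_of_intModel_of_root q W hI hv hΔ hc₄ t ht
  have hW's := hasSplitMultiplicativeReductionAt_of_intModel_of_root q W' hI' hv hΔ' hc₄' t' ht'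
  have hcard : Nat.card (nsmulAddMonoidHom 3 : (W.baseChange (v.adicCompletion ℚ)).toAffine.Point →+
      (W.baseChange (v.adicCompletion ℚ)).toAffine.Point).ker ≤ 3 := by
    rw [natCard_ker_nsmul_three_adicCompletion_eq_of_intModel_of_certAt q a₁ a₂ a₃ a₄ a₆ hq3 W hI
      hcert hv]
    omega
  exact W.relIndex_map_selmerLocalKer_eq_one_of_hasSplitMultiplicativeReductionAt v hU W' θ hθ hWs
    hW's hcard

end KindIICert

end Summit.BirchSwinnertonDyer.Rank1Residual.GaloisImage.DivisionDecider

end
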